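import Literature.AlgebraicGeometry.Motives.RatFnBirational
import Literature.AlgebraicGeometry.Motives.RatFnSpec
import Literature.AlgebraicGeometry.Resolution.BlowupsFlatBaseChange
import HarnessLib

/-!
# A morphism defined on an open, which is an isomorphism over a dense open: dominance, stalk
# isomorphisms, and the induced automorphism of the function field

Topic `Literature/AlgebraicGeometry/Motives` (proofs only; no definitions, no named facts).  Let `Y` be
an integral scheme, `U₀ ≤ D` opens of `Y` with `U₀` non-empty, and `Φ : D → Y` a morphism with
`Φ⁻¹ U₀ = D ∩ U₀` whose restriction `Φ ∣_ U₀ : Φ⁻¹ U₀ → U₀` is an isomorphism (the situation of a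
rational map `Y ⇢ Y` defined on `D` and restricting to an automorphism of the open `U₀`; for the
cell: the shear `(pr₁, m)` of a birational group law on the generic-fibre open of `𝒳 ×_R 𝒳`,
Bosch–Lütkebohmert–Raynaud, *Néron Models*, §5.1).  Then:

* `preimage_eq_preimage_ι_of_comp_eq` — the hypothesis `Φ⁻¹ U₀ = D ∩ U₀` from «`Φ` is a morphism
  over a base of which `U₀` is a fibre-preimage»; `mem_iff_mem_of_preimage_eq` — `Φ q ∈ U₀ ↔ q ∈ U₀`;
* `isDominant_ι_of_le`, `isDominant_of_isIso_morphismRestrict` — `D ↪ Y` and `Φ` are dominant;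
* `isIso_stalkMap_of_mem` — `Φ♯_q` is an isomorphism at every `q ∈ D ∩ U₀`
  (★ `Resolution.isIso_stalkMap_of_isIso_morphismRestrict`);
* `functionFieldMap_bijective_of_isIso_morphismRestrict'`,
  `exists_functionField_endomorphism_of_isIso_morphismRestrict` — `Φ♯ : K(Y) → K(D)` is bijective
  (★ `RatFn.functionFieldMap_bijective_of_isIso_morphismRestrict`), hence there is a unique ring
  AUTOMORPHISM `σ` of `K(Y)` with `(D ↪ Y)♯ ∘ σ = Φ♯`, i.e. «`σ = Φ♯` read in `K(Y) ≅ K(D)`»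
  (Görtz–Wedhorn I, Def. 9.33 / Prop. 9.34: birational maps and function fields).

Cell `hodgecm-mathlib`, road W of `r₀` ((W0) leaf ISO-PACK: the inputs `[IsDominant ΦD]`, `hiso`,
`σ`, `hσ`, `hσbij` of `stub_L4c'` / `core_fst`).

## Sources

* U. Görtz, T. Wedhorn, *Algebraic Geometry I: Schemes*, 2nd ed., Springer Spektrum 2020, Def. 9.33,
  Prop. 9.34 (rational maps, birational maps and function fields). [GortzWedhorn2020]
* S. Bosch, W. Lütkebohmert, M. Raynaud, *Néron Models*, Springer 1990, §5.1 (birational group laws).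
  [BLRNeronModels1990]
-/

noncomputable section

universe u

namespace Literature.AlgebraicGeometry.Motives

open CategoryTheory _root_.AlgebraicGeometry TopologicalSpace
open Literature.AlgebraicGeometry.Motives.RatFn

variable {Y : Scheme.{u}} {U₀ D : Y.Opens} (hD : U₀ ≤ D) (ΦD : (D : Scheme.{u}) ⟶ Y)
  (hΦU : ΦD ⁻¹ᵁ U₀ = D.ι ⁻¹ᵁ U₀)

include hΦU in
/-- `Φ q ∈ U₀ ↔ q ∈ U₀` for `q ∈ D`, when `Φ⁻¹ U₀ = D ∩ U₀`. [folklore] -/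
private theorem mem_iff_mem_of_preimage_eq (q : (D : Scheme.{u})) : ΦD q ∈ U₀ ↔ D.ι q ∈ U₀ := by
  change q ∈ ΦD ⁻¹ᵁ U₀ ↔ q ∈ D.ι ⁻¹ᵁ U₀
  rw [hΦU]

/-- **`Φ⁻¹ U₀ = D ∩ U₀` for a morphism over a base**: if `U₀ = p⁻¹ V` is the preimage of an open of
a base `S` (e.g. the generic-fibre open) and `Φ` is a morphism over `S` (`Φ ≫ p = (D ↪ Y) ≫ p`),
then `Φ⁻¹ U₀ = D ∩ U₀` — the hypothesis `hΦU` of this file. [cite: GortzWedhorn2020, Prop. 9.34] -/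
theorem preimage_eq_preimage_ι_of_comp_eq {S : Scheme.{u}} (pY : Y ⟶ S) (V : S.Opens)
    (hover : ΦD ≫ pY = D.ι ≫ pY) : ΦD ⁻¹ᵁ (pY ⁻¹ᵁ V) = D.ι ⁻¹ᵁ (pY ⁻¹ᵁ V) := by
  change (ΦD ≫ pY) ⁻¹ᵁ V = (D.ι ≫ pY) ⁻¹ᵁ V
  rw [hover]

include hD in
/-- **`D ↪ Y` is dominant** when `D` contains a non-empty open `U₀` of the irreducible scheme `Y`.
[cite: GortzWedhorn2020, Prop. 9.34] -/
theorem isDominant_ι_of_le [IrreducibleSpace Y] [Nonempty U₀] : IsDominant D.ι := by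
  refine Opens.isDominant_ι (D.2.dense ?_)
  obtain ⟨⟨y, hy⟩⟩ := ‹Nonempty U₀›
  exact ⟨y, hD hy⟩

/-- **`Φ` is dominant**: its image contains the dense open `U₀` (`Φ ∣_ U₀` is an isomorphism onto
`U₀`). [cite: GortzWedhorn2020, Prop. 9.34] -/
theorem isDominant_of_isIso_morphismRestrict [IrreducibleSpace Y] [Nonempty U₀] [IsIso (ΦD ∣_ U₀)] :
    IsDominant ΦD := by
  refine ⟨?_⟩
  have hdense : Dense (U₀ : Set Y) := U₀.2.dense (by
    obtain ⟨⟨y, hy⟩⟩ := ‹Nonempty U₀›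
    exact ⟨y, hy⟩)
  refine hdense.mono ?_
  rintro y hy
  -- `Φ ∣_ U₀` is surjective onto `U₀`
  obtain ⟨x, hx⟩ := (ΦD ∣_ U₀).surjective ⟨y, hy⟩
  refine ⟨x.1, ?_⟩
  have := congrArg Subtype.val hx
  rw [morphismRestrict_base_coe] at this
  exact this

include hΦU in
/-- **`Φ♯_q` is an isomorphism at every point `q ∈ D ∩ U₀`** (`Φ` restricts to an isomorphism over
`U₀`; ★ `Resolution.isIso_stalkMap_of_isIso_morphismRestrict`). [cite: GortzWedhorn2020, Prop. 9.34] -/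
theorem isIso_stalkMap_of_mem [IsIso (ΦD ∣_ U₀)] (q : (D : Scheme.{u})) (hq : D.ι q ∈ U₀) :
    IsIso (ΦD.stalkMap q) :=
  Literature.AlgebraicGeometry.Resolution.isIso_stalkMap_of_isIso_morphismRestrict ΦD U₀ q
    ((mem_iff_mem_of_preimage_eq ΦD hΦU q).mpr hq)

include hD in
/-- The open `D` is non-empty (private helper). [folklore] -/
private theorem nonempty_of_le [Nonempty U₀] : Nonempty D := by
  obtain ⟨⟨y, hy⟩⟩ := ‹Nonempty U₀›
  exact ⟨⟨y, hD hy⟩⟩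

variable [IsIntegral Y] [Nonempty U₀]

include hD hΦU in
/-- **`Φ♯ : K(Y) → K(D)` is bijective** (`Φ` dominant, an isomorphism over the dense open `U₀` with
dense preimage `D ∩ U₀`; ★ `RatFn.functionFieldMap_bijective_of_isIso_morphismRestrict`).
[cite: GortzWedhorn2020, Def. 9.33] -/
theorem functionFieldMap_bijective_of_isIso_morphismRestrict' [IsIso (ΦD ∣_ U₀)] [IsDominant ΦD] :
    haveI : Nonempty D := nonempty_of_le hD
    Function.Bijective (functionFieldMap ΦD) := by
  haveI : Nonempty D := nonempty_of_le hD
  obtain ⟨⟨y, hy⟩⟩ := ‹Nonempty U₀›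
  have hU : Dense ((U₀ : Y.Opens) : Set Y) := U₀.2.dense ⟨y, hy⟩
  have hU' : Dense ((ΦD ⁻¹ᵁ U₀ : (D : Scheme.{u}).Opens) : Set D) := by
    rw [hΦU]
    refine (D.ι ⁻¹ᵁ U₀).2.dense ⟨⟨y, hD hy⟩, ?_⟩
    change D.ι ⟨y, hD hy⟩ ∈ U₀
    exact hy
  exact functionFieldMap_bijective_of_isIso_morphismRestrict ΦD U₀ hU hU'

include hD hΦU in
/-- **The automorphism of `K(Y)` induced by `Φ`.** There is a ring endomorphism `σ` of `K(Y)` with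
`(D ↪ Y)♯ ∘ σ = Φ♯` («`σ = Φ♯` read through `K(Y) ≅ K(D)`, ★ `RatFn.functionFieldEquiv`), and it is
bijective (Görtz–Wedhorn I, Def. 9.33: a birational self-map acts on the function field by an
automorphism). [cite: GortzWedhorn2020, Def. 9.33] -/
theorem exists_functionField_endomorphism_of_isIso_morphismRestrict [IsIso (ΦD ∣_ U₀)]
    [IsDominant ΦD] [IsDominant D.ι] :
    haveI : Nonempty D := nonempty_of_le hD
    ∃ σ : Y.functionField →+* Y.functionField,
      (functionFieldMap D.ι).comp σ = functionFieldMap ΦD ∧ Function.Bijective σ := by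
  haveI : Nonempty D := nonempty_of_le hD
  let e := functionFieldEquiv D.ι
  refine ⟨e.symm.toRingHom.comp (functionFieldMap ΦD), ?_, ?_⟩
  · ext x
    change e (e.symm (functionFieldMap ΦD x)) = functionFieldMap ΦD x
    exact e.apply_symm_apply _
  · exact e.symm.bijective.comp
      (functionFieldMap_bijective_of_isIso_morphismRestrict' hD ΦD hΦU)

end Literature.AlgebraicGeometry.Motives

end
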